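import Mathlib
import Literature.Analysis.Fourier.FejerJacksonKernels
import HarnessLib

/-!
# Route TaylorCertificates — `PacketLemma`, helper 2: the Fejér–Jackson window on the circle

One-dimensional input for the envelope of the trigonometric packet in the proof of
`Summit.AnomalousDissipation.AnomalousDissipation.Theses.TaylorCertificates.PacketLemma`
(item stmt-AnomalousDissipation-14032). On `UnitAddCircle` put
`χ_M(v) = ∑_{j=0}^{M} e_j(v)` (`e_j = fourier j`); then `|χ_M|² = (M+1) F_M` is the Fejér kernel
and `|χ_M|⁴ = (M+1)² F_M²` the (unnormalised) Jackson kernel. We record: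

* `dirChar_coe`, `norm_sq_dirChar_coe` — on representatives `χ_M(t) = D_M(t)` and
  `|χ_M(t)|² = (M+1) F_M(t)` (the tree's `TrigApprox.dirSum`, `TrigApprox.fejer`);
* `integral_norm_sq_dirChar` (`∫ |χ_M|² = M+1`), `integral_norm_four_dirChar_ge`
  (`∫ |χ_M|⁴ ≥ 8(M+1)³/π⁴`, the tree's `TrigApprox.jacksonConst_ge`);
* `norm_sq_dirChar_mul_le` — the telescoping bound `|χ_M(v)|² |1 - e_1(v)|² ≤ 4`
  (`(1 - e_1) χ_M = 1 - e_{M+1}`), i.e. `F_M(t) sin²(πt) ≤ 1/(M+1)`;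
* `norm_sq_dirChar_eq_sum` — the expansion `|χ_M(v)|² = ∑_{|h| ≤ M} #{j - j' = h} e_h(v)`;
* `norm_one_sub_fourier_one_coe` — `|1 - e_1(t)| = 2 |sin(π t)|`.

No named facts; the only definitions are the explicit finite sums `dirChar`, `diffCount`.
-/

noncomputable section

open MeasureTheory Real Complex
open scoped ComplexConjugate

namespace Summit.AnomalousDissipation.AnomalousDissipation.Theorems

-- the mandated namespace `Summit.<Summit>.<Problem>.Theorems` repeats `AnomalousDissipation` (single-problem summit)
set_option linter.dupNamespace false

open Literature.Analysis.Fourier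

/-- The one-sided character sum `χ_M(v) = ∑_{j=0}^{M} e_j(v)` on the unit circle (a Dirichlet-type
kernel whose squared modulus is `(M+1)` times the Fejér kernel). [folklore] -/
def dirChar (M : ℕ) (v : UnitAddCircle) : ℂ := ∑ j ∈ Finset.range (M + 1), fourier (j : ℤ) v

/-- `χ_M` is continuous. [folklore] -/
theorem continuous_dirChar (M : ℕ) : Continuous (dirChar M) := by
  unfold dirChar
  exact continuous_finsetSum _ fun j _ => (fourier (j : ℤ)).continuous

/-- On representatives, `χ_M(t)` is the tree's `dirSum M t = ∑_{j ≤ M} e(jt)`. [folklore] -/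
theorem dirChar_coe (M : ℕ) (t : ℝ) : dirChar M (t : UnitAddCircle) = TrigApprox.dirSum M t := by
  unfold dirChar TrigApprox.dirSum TrigApprox.e
  refine Finset.sum_congr rfl fun j _ => ?_
  rw [fourier_coe_apply]
  congr 1
  push_cast
  ring1

/-- `|χ_M(t)|² = (M+1) F_M(t)` with the tree's Fejér kernel `TrigApprox.fejer`. [folklore] -/
theorem norm_sq_dirChar_coe (M : ℕ) (t : ℝ) :
    ‖dirChar M (t : UnitAddCircle)‖ ^ 2 = (M + 1) * TrigApprox.fejer M t := by
  rw [dirChar_coe, TrigApprox.fejer]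
  have hM : (0 : ℝ) < M + 1 := by positivity
  field_simp

/-- `∫_{𝕋} |χ_M|² = M + 1` (from `∫₀¹ F_M = 1`). [folklore] -/
theorem integral_norm_sq_dirChar (M : ℕ) :
    ∫ v : UnitAddCircle, ‖dirChar M v‖ ^ 2 = M + 1 := by
  have h := AddCircle.intervalIntegral_preimage 1 0 (fun v => ‖dirChar M v‖ ^ 2)
  rw [zero_add] at h
  rw [← h]
  simp_rw [norm_sq_dirChar_coe]
  rw [intervalIntegral.integral_const_mul, TrigApprox.integral_fejer, mul_one]

/-- `∫_{𝕋} |χ_M|⁴ ≥ 8 (M+1)³ / π⁴` (the tree's lower bound `TrigApprox.jacksonConst_ge` for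
`∫₀¹ F_M²`). [folklore] -/
theorem integral_norm_four_dirChar_ge (M : ℕ) :
    8 * (M + 1) ^ 3 / π ^ 4 ≤ ∫ v : UnitAddCircle, ‖dirChar M v‖ ^ 4 := by
  have h := AddCircle.intervalIntegral_preimage 1 0 (fun v => ‖dirChar M v‖ ^ 4)
  rw [zero_add] at h
  rw [← h]
  have h4 : ∀ t : ℝ, ‖dirChar M (t : UnitAddCircle)‖ ^ 4 = (M + 1) ^ 2 * TrigApprox.fejer M t ^ 2 := by
    intro t
    rw [show (4 : ℕ) = 2 * 2 from rfl, pow_mul, norm_sq_dirChar_coe]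
    ring1
  simp_rw [h4]
  rw [intervalIntegral.integral_const_mul]
  have hJ := TrigApprox.jacksonConst_ge M
  rw [TrigApprox.jacksonConst] at hJ
  have hM : (0 : ℝ) ≤ (M + 1) ^ 2 := by positivity
  calc 8 * ((M : ℝ) + 1) ^ 3 / π ^ 4 = (M + 1) ^ 2 * (8 * (M + 1) / π ^ 4) := by ring
    _ ≤ (M + 1) ^ 2 * ∫ x in (0 : ℝ)..1, TrigApprox.fejer M x ^ 2 :=
        mul_le_mul_of_nonneg_left hJ hM

/-- Telescoping: `(1 - e_1(v)) χ_M(v) = 1 - e_{M+1}(v)`. [folklore] -/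
theorem one_sub_fourier_mul_dirChar (M : ℕ) (v : UnitAddCircle) :
    (1 - fourier 1 v) * dirChar M v = 1 - fourier ((M + 1 : ℕ) : ℤ) v := by
  unfold dirChar
  have htel := Finset.sum_range_sub (fun j : ℕ => (fourier (j : ℤ) v : ℂ)) (M + 1)
  simp only [Nat.cast_zero, fourier_zero] at htel
  rw [sub_mul, one_mul, Finset.mul_sum]
  have h1 : ∀ j ∈ Finset.range (M + 1), fourier 1 v * fourier (j : ℤ) v = fourier ((j + 1 : ℕ) : ℤ) v := by
    intro j _
    rw [← fourier_add]
    congr 1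
    push_cast
    rw [add_comm]
  rw [Finset.sum_congr rfl h1]
  have h2 : ∑ j ∈ Finset.range (M + 1), (fourier (j : ℤ) v - fourier ((j + 1 : ℕ) : ℤ) v : ℂ) =
      -(fourier ((M + 1 : ℕ) : ℤ) v - 1) := by
    rw [← htel, ← Finset.sum_neg_distrib]
    refine Finset.sum_congr rfl fun j _ => ?_
    ring1
  rw [← Finset.sum_sub_distrib, h2]
  ring1

/-- The characters have modulus one. [folklore] -/
theorem norm_fourier_apply (n : ℤ) (v : UnitAddCircle) : ‖(fourier n v : ℂ)‖ = 1 := by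
  rw [fourier_apply, Circle.norm_coe]

/-- **The Fejér window is small away from the origin**: `|χ_M(v)|² |1 - e_1(v)|² ≤ 4`, i.e.
`F_M(t) sin²(πt) = sin²(π(M+1)t)/(M+1) ≤ 1/(M+1)`. [folklore] -/
theorem norm_sq_dirChar_mul_le (M : ℕ) (v : UnitAddCircle) :
    ‖dirChar M v‖ ^ 2 * ‖(1 : ℂ) - fourier 1 v‖ ^ 2 ≤ 4 := by
  rw [← mul_pow, mul_comm, ← norm_mul, one_sub_fourier_mul_dirChar]
  have h : ‖(1 : ℂ) - fourier ((M + 1 : ℕ) : ℤ) v‖ ≤ 2 :=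
    (norm_sub_le _ _).trans (by rw [norm_one, norm_fourier_apply]; norm_num)
  nlinarith [norm_nonneg ((1 : ℂ) - fourier ((M + 1 : ℕ) : ℤ) v)]

/-- `|1 - e_1(t)| = 2 |sin(π t)|` on representatives. [folklore] -/
theorem norm_one_sub_fourier_one_coe (t : ℝ) :
    ‖(1 : ℂ) - fourier 1 (t : UnitAddCircle)‖ = 2 * |Real.sin (π * t)| := by
  rw [fourier_coe_apply, norm_sub_rev]
  rw [show (2 * π * Complex.I * ((1 : ℤ) : ℂ) * t / ((1 : ℝ) : ℂ) : ℂ) = Complex.I * ((2 * π * t : ℝ) : ℂ) by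
    push_cast; ring]
  rw [Complex.norm_exp_I_mul_ofReal_sub_one, show (2 * π * t) / 2 = π * t by ring, norm_mul,
    Real.norm_eq_abs, Real.norm_eq_abs, abs_of_pos two_pos]

/-- The number of pairs `(j, j') ∈ {0,…,M}²` with `j - j' = h` — the Fourier coefficient of
`|χ_M|²` at `h` (it equals `M + 1 - |h|` for `|h| ≤ M`, a value never needed). [folklore] -/
def diffCount (M : ℕ) (h : ℤ) : ℕ :=
  ((Finset.range (M + 1) ×ˢ Finset.range (M + 1)).filter fun p => (p.1 : ℤ) - p.2 = h).card

/-- **Fourier expansion of the Fejér window**: `|χ_M(v)|² = ∑_{h=-M}^{M} #{j - j' = h} e_h(v)`. [folklore] -/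
theorem norm_sq_dirChar_eq_sum (M : ℕ) (v : UnitAddCircle) :
    ((‖dirChar M v‖ ^ 2 : ℝ) : ℂ) =
      ∑ h ∈ Finset.Icc (-(M : ℤ)) M, (diffCount M h : ℂ) * fourier h v := by
  rw [← Complex.normSq_eq_norm_sq, ← Complex.mul_conj]
  unfold dirChar
  rw [map_sum, Finset.sum_mul_sum, ← Finset.sum_product']
  simp_rw [← fourier_neg, ← fourier_add]
  -- regroup the double sum along the fibres of `(j, j') ↦ j - j'`
  have hmaps : ∀ p ∈ Finset.range (M + 1) ×ˢ Finset.range (M + 1),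
      (p.1 : ℤ) - p.2 ∈ Finset.Icc (-(M : ℤ)) M := by
    intro p hp
    rw [Finset.mem_product, Finset.mem_range, Finset.mem_range] at hp
    rw [Finset.mem_Icc]
    omega
  rw [← Finset.sum_fiberwise_of_maps_to hmaps]
  refine Finset.sum_congr rfl fun h _ => ?_
  have hinner : ∀ p ∈ (Finset.range (M + 1) ×ˢ Finset.range (M + 1)).filter
      (fun p => (p.1 : ℤ) - p.2 = h), (fourier (((p.1 : ℕ) : ℤ) + -((p.2 : ℕ) : ℤ)) v : ℂ) = fourier h v := by
    intro p hp
    rw [Finset.mem_filter] at hp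
    rw [← hp.2, sub_eq_add_neg]
  rw [Finset.sum_congr rfl hinner, Finset.sum_const, nsmul_eq_mul, diffCount]

end Summit.AnomalousDissipation.AnomalousDissipation.Theorems
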